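import Literature.MathematicalPhysics.QuantumFieldTheory.Balaban1983to89.FlowStep
import Literature.MathematicalPhysics.QuantumFieldTheory.Balaban1983to89.Node00.Record13
import Literature.MathematicalPhysics.QuantumFieldTheory.Balaban1983to89.Node00.Record13SepCoPH
import Literature.MathematicalPhysics.QuantumFieldTheory.Balaban1983to89.Node00.Record13Carriers
import Literature.MathematicalPhysics.QuantumFieldTheory.Balaban1983to89.Node00.CarriersB8
import Literature.MathematicalPhysics.QuantumFieldTheory.Balaban1983to89.Node00.Record13SClassSepCoPH
import Literature.MathematicalPhysics.QuantumFieldTheory.Balaban1983to89.Node00.N24NodesWindowStage12C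
import Literature.MathematicalPhysics.QuantumFieldTheory.Balaban1983to89.T4DatumAssemblyTower

/-!
# K1⁷ `StabilityBAtRecordR13SepCoPH` — NEGATIVE LEMMA: the WITNESS-KEYED sign∕ceiling box is false on every family with ONE rung-1 witness

Cell ym-nodeO-ideate.  Mathematics: idea seat ym-nodeO-idea-2 gen 5 (crux idea `k1-ceiling-before-world`, sketch `Idea2g5CeilingBeforeWorldSketch.lean` §1–§2,
evidence n°30 on stmt-QuantumFields-20542); landed verbatim (renamed namespace, one corollary added) by the critic seat ym-nodeO-crit-1 gen 4 on director-ym №26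
(triage sheet `Cruxes/StabilityBAtRecordR13SepCoPH/CRIT-1-TRIAGE-k1-ceiling-before-world.md`).  Imports are LITERATURE-ONLY (the ★★★ file's own Literature imports): this module sits
outside the Theses cone and asserts nothing about any route decl.

WHAT IS REFUTED (and what is NOT).  The tree concluder `BalabanUVNodesK1EndOfNodes13PWSOfSignBoxH` :246
`stabilityBAtRecordR13SepCoPH_of_stub1_of_signBoxH_at_witness (h₁ …) (hsign …)` takes `hsign` = «at EVERY rung-1 witness `(θ, h, w)`: `∃ γ₀ > 0`, `0 ≤ β_θ` and `β_θ ≤ w.βup`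
on `]0, γ₀]^{k+1}`», keyed on the witness's OWN ceiling letter `w.βup`.  The thirteen DAG nodes are ANTITONE in `w.βup` (only N11 `Dag.B14_main` reads `flowControl`, as a
HYPOTHESIS, and `B14.FlowIneq26` is monotone in `β′`), so every rung-1 witness `w` has twins `withCeiling w B`, `B ≤ w.βup` arbitrarily negative, that are again rung-1
witnesses; at the twin with `B = min w.βup (−1)` the letter says `0 ≤ β_θ 0 (γ₀) ≤ −1`.  Hence: ONE rung-1 witness (= what `h₁`, the registered stub 1 `stub_nodes13PWS` of
K1 skeleton v5 38c62055d1ac34a4 ∕ v6 03f66ac9cc89391f, delivers on an inhabited family) makes `hsign F` FALSE — `h₁` and `hsign` are jointly inconsistent on every inhabited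
family (`hsign_false_of_rung1_witness`, typed against ★★★'s two hypothesis shapes verbatim).  NOT refuted: the registered stubs themselves (v5 `stub_betaWindow13PWS`, v6
`stub_runRows13PWS` key the ceiling at an OUTPUT ∃-world, not at every witness), the crux, or any node.  Moral for cuts: β-side conclusions WORLD-FREE, or the world keyed AFTER
the ceiling (`∀ c, ∃ w, c ≤ w.βup ∧ …`) — print's order ([Balaban1987RG1] §1 p.264; [Balaban1988Convergent] (2.6) p.255: `β′, β₀` given, `γ = γ(β′, β₀)`).

HONEST SCOPE: negative knowledge about ONE typed road; count-neutral; nothing of Bałaban's asserted; K1⁷ NOT closed; `route-QuantumFields-BalabanUVNodes` closes only the CONDITIONAL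
finite-𝕋⁴ rung `BalabanLadder.UV`; the Yang–Mills mass gap (Clay) is NOT proved by anything here.
-/

noncomputable section

namespace Summit.QuantumFields.YangMills.Theorems.StabilityBAtRecordR13SepCoPH.Negative.SignBoxAtEveryWitnessFalse

open Literature.MathematicalPhysics.QuantumFieldTheory.Balaban1983to89
open Literature.MathematicalPhysics.QuantumFieldTheory.Balaban1983to89.Node00
open DagBinding T4Continuum T4DatumAssembly
open FlowStep (BetaLowerH BetaUpperH Box)


/-- (2.6)'s first member is monotone in the constant `β′` (for nonnegative couplings). [cite: Balaban1988Convergent, (2.6) p.255] -/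
theorem flowIneq26_mono_beta {g : ℕ → ℝ} {β₁ β₂ β₀ : ℝ} {K : ℕ} (hβ : β₁ ≤ β₂) (hpos : ∀ j, j ≤ K → 0 < g j)
    (h : B14.FlowIneq26 g β₁ β₀ K) : B14.FlowIneq26 g β₂ β₀ K := by
  intro m n hmn hnK
  obtain ⟨h1, h2⟩ := h m n hmn hnK
  refine ⟨h1.trans ?_, h2⟩
  have hgm : 0 ≤ g m := (hpos m (by omega)).le
  apply mul_le_mul_of_nonneg_right _ hgm
  apply Real.sqrt_le_sqrt
  have hnm : (0 : ℝ) ≤ (n : ℝ) - m := by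
    have : (m : ℝ) < n := by exact_mod_cast hmn
    linarith
  have : 0 ≤ (g n) ^ 2 * ((n : ℝ) - m) := mul_nonneg (sq_nonneg _) hnm
  nlinarith

/-- The world with its ceiling letter replaced. [folklore] -/
def withCeiling (w : WorldP) (B : ℝ) : WorldP := { w with βup := B }

/-- The replaced ceiling letter. [folklore] -/
@[simp] theorem withCeiling_βup (w : WorldP) (B : ℝ) : (withCeiling w B).βup = B := rfl
/-- `withCeiling` keeps the carrier. [folklore] -/
@[simp] theorem withCeiling_C (w : WorldP) (B : ℝ) : (withCeiling w B).C = w.C := rfl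
/-- `withCeiling` keeps the coupling radius. [folklore] -/
@[simp] theorem withCeiling_γ (w : WorldP) (B : ℝ) : (withCeiling w B).γ = w.γ := rfl
/-- `withCeiling` keeps `L`. [folklore] -/
@[simp] theorem withCeiling_L (w : WorldP) (B : ℝ) : (withCeiling w B).L = w.L := rfl
/-- `withCeiling` keeps the upstream data. [folklore] -/
@[simp] theorem withCeiling_up (w : WorldP) (B : ℝ) : (withCeiling w B).up = w.up := rfl

/-- **THE THIRTEEN DAG NODES ARE ANTITONE IN `w.βup`.**  Of the 22 leaves of `leavesP w P` only `running`, `betaSmoothBounded` and `flowControl` mention `w.βup`, and of the thirteen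
mains only N11 = `Dag.B14_main` reads one of them — `flowControl`, as the HYPOTHESIS `(smallCouplings → flowControl)`; (2.6) with a SMALLER constant implies (2.6) with the original one
(`flowIneq26_mono_beta`, couplings positive by `smallCouplings`).  So lowering the ceiling letter preserves all thirteen nodes. [folklore] -/
theorem nodes_leavesP_lowerβup (w : WorldP) {B : ℝ} (hB : B ≤ w.βup) (P : B12.RunParams) (hn : Nodes (leavesP w P)) :
    Nodes (leavesP (withCeiling w B) P) := by
  obtain ⟨h4, h5, h6, h7, h8, h9, h10, h11, h12, h13, h14, h15, h16⟩ := hn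
  refine ⟨h4, h5, h6, h7, h8, h9, h10, h11, h12, h13, ?_, h15, h16⟩
  intro h7' h8' h9' h10' h11' hsf hfc
  have hfc' : (leavesP w P).smallCouplings → (leavesP w P).flowControl := fun hsc =>
    flowIneq26_mono_beta hB (fun j hj => ((hsc : (w.C P).flow.InInterval w.γ P.K) j hj).1) (hfc hsc)
  exact h14 h7' h8' h9' h10' h11' hsf hfc'

/-! ## §2. Negative control: the witness-keyed sign box is unsatisfiable -/

section NegativeControl

variable (F : T4Family)

/-- The rung-1 conjuncts of the REGISTERED v5 stub 1 at `(θ, h, w)` (plan's `RecordS` unfolded, nodes, `PrintedUV3V`, the [IV]-pin), VERBATIM the antecedents of dag-n24-w1's `hsign`. -/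
def Rung1At (θ : Stage13HParams F 2) (h : θ.Provisos₁₃SepCoPH F 2) (w : WorldP) : Prop :=
  (θ.ZhUnity F 2 ∧ θ.SlotsNondegenerate₁₃ F 2) ∧ θ.Admissible F 2 ∧
    (∃ (θ' : Stage13HParams F 2) (h' : θ'.Provisos₁₃SepCoPH F 2), θ'.Admissible F 2 ∧
      datumOfRecord₁₃SepCoPH F 2 θ h = datumOfRecord₁₃SepCoPH F 2 θ' h' ∧ w.C = (datumOfRecord₁₃SepCoPH F 2 θ h).C ∧ (0 < w.γ ∧ w.γ ≤ θ'.γ) ∧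
      w.L = (θ'.L : ℝ) ∧ ∀ P : B12.RunParams, w.up P = upOfRecord₅CS F 2 (θ'.toStage5₁₃CoPH F 2) P) ∧
    (∀ P : B12.RunParams, Nodes (leavesP w P)) ∧ PrintedUV3V 2 θ.L ∧
    ∃ lam : ResidW F 2, (∀ P : B12.RunParams, 1 ≤ P.K → lam.kSel P < P.K) ∧
      ∀ P : B12.RunParams, lam.kSel P < P.K → ((leavesP w P).rBasicStep ↔ B15Leaf (WOfRecord₁₃ F 2 θ.toStage13Params lam P))

/-- Rung-1 data pass to every ceiling-lowered twin (the record class, `PrintedUV3V` and the [IV]-pin never read `βup`; the nodes by §1). [folklore] -/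
theorem rung1At_lowerβup {θ : Stage13HParams F 2} {h : θ.Provisos₁₃SepCoPH F 2} {w : WorldP} (hr : Rung1At F θ h w) {B : ℝ} (hB : B ≤ w.βup) :
    Rung1At F θ h (withCeiling w B) := by
  obtain ⟨hU, hθ, hR, hnodes, h08, lam, hsel, hpin⟩ := hr
  exact ⟨hU, hθ, hR, fun P => nodes_leavesP_lowerβup w hB P (hnodes P), h08, lam, hsel, fun P hP => hpin P hP⟩

/-- dag-n24-w1's witness-keyed sign-box letter for the family `F` (hypothesis `hsign F` of `stabilityBAtRecordR13SepCoPH_of_stub1_of_signBoxH_at_witness`, conjuncts bundled). -/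
def SignBoxAtEveryWitness : Prop :=
  ∀ (θ : Stage13HParams F 2) (h : θ.Provisos₁₃SepCoPH F 2) (w : WorldP), Rung1At F θ h w →
    ∃ γ₀ : ℝ, 0 < γ₀ ∧ BetaLowerH 0 γ₀ (betaOfRecord₁₃ F 2 θ.toStage13Params) ∧ BetaUpperH w.βup γ₀ (betaOfRecord₁₃ F 2 θ.toStage13Params)

/-- **NEGATIVE CONTROL.**  If ONE rung-1 witness exists for `F` (which is what the registered stub 1 delivers from K0⁷), the witness-keyed sign box is FALSE: the twin `withCeiling w (-1)`
(or lower) is again a rung-1 witness (§1), and at it the letter says `0 ≤ β_θ 0 (γ₀) ≤ -1`.  So the hypotheses `h₁`, `hsign` of dag-n24-w1's ★★★ are jointly inconsistent on every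
inhabited family — the ceiling cannot be keyed on the witness's own `w.βup`. [folklore] -/
theorem signBoxAtEveryWitness_false (hex : ∃ (θ : Stage13HParams F 2) (h : θ.Provisos₁₃SepCoPH F 2) (w : WorldP), Rung1At F θ h w)
    (hbox : SignBoxAtEveryWitness F) : False := by
  obtain ⟨θ, h, w, hr⟩ := hex
  have hB : min w.βup (-1) ≤ w.βup := min_le_left _ _
  obtain ⟨γ₀, hγ₀, hlo, hhi⟩ := hbox θ h (withCeiling w (min w.βup (-1))) (rung1At_lowerβup F hr hB)
  have hv : (fun _ : Fin (0 + 1) => γ₀) ∈ Box γ₀ 0 := FlowStep.mem_box.2 fun _ => ⟨hγ₀, le_rfl⟩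
  have h0 := hlo 0 _ hv
  have h1 := hhi 0 _ hv
  have : betaOfRecord₁₃ F 2 θ.toStage13Params 0 (fun _ => γ₀) ≤ -1 := h1.trans ((min_le_right _ _).trans_eq rfl)
  linarith

end NegativeControl

/-! ## §3. The same kill typed against the tree concluder's two hypothesis shapes VERBATIM -/

section AgainstTheRoad
variable (F : T4Family)

/-- **`h₁ ∧ hsign ⟹ False` on every inhabited family.**  `h₁` and `hsign` are the two hypothesis TYPES of
`BalabanUVNodesK1EndOfNodes13PWSOfSignBoxH.stabilityBAtRecordR13SepCoPH_of_stub1_of_signBoxH_at_witness` (:246) letter for letter (`h₁` = the registered stub-1 text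
`Inhabited13 F → NodesAtSomeRecord13PWS F` with `RecordS` unfolded); given one K0⁷ tuple on `F` they cannot both hold.  So that road to K1⁷ is closed AS TYPED — the
ceiling∕sign box must not be keyed on the witness's own `w.βup`. [folklore] -/
theorem hsign_false_of_rung1_witness
    (h₁ : ∀ F : T4Family, (∃ θ : Stage13HParams F 2, θ.Provisos₁₃SepCoPH F 2 ∧ (θ.ZhUnity F 2 ∧ θ.SlotsNondegenerate₁₃ F 2) ∧ θ.Admissible F 2) →
      ∃ (θ : Stage13HParams F 2) (h : θ.Provisos₁₃SepCoPH F 2) (w : WorldP), (θ.ZhUnity F 2 ∧ θ.SlotsNondegenerate₁₃ F 2) ∧ θ.Admissible F 2 ∧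
        (∃ (θ' : Stage13HParams F 2) (h' : θ'.Provisos₁₃SepCoPH F 2), θ'.Admissible F 2 ∧
          datumOfRecord₁₃SepCoPH F 2 θ h = datumOfRecord₁₃SepCoPH F 2 θ' h' ∧ w.C = (datumOfRecord₁₃SepCoPH F 2 θ h).C ∧ (0 < w.γ ∧ w.γ ≤ θ'.γ) ∧
          w.L = (θ'.L : ℝ) ∧ ∀ P : B12.RunParams, w.up P = upOfRecord₅CS F 2 (θ'.toStage5₁₃CoPH F 2) P) ∧
        (∀ P : B12.RunParams, Nodes (leavesP w P)) ∧ PrintedUV3V 2 θ.L ∧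
        ∃ lam : ResidW F 2, (∀ P : B12.RunParams, 1 ≤ P.K → lam.kSel P < P.K) ∧
          ∀ P : B12.RunParams, lam.kSel P < P.K → ((leavesP w P).rBasicStep ↔ B15Leaf (WOfRecord₁₃ F 2 θ.toStage13Params lam P)))
    (hsign : ∀ (F : T4Family) (θ : Stage13HParams F 2) (h : θ.Provisos₁₃SepCoPH F 2) (w : WorldP),
      (θ.ZhUnity F 2 ∧ θ.SlotsNondegenerate₁₃ F 2) → θ.Admissible F 2 →
      (∃ (θ' : Stage13HParams F 2) (h' : θ'.Provisos₁₃SepCoPH F 2), θ'.Admissible F 2 ∧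
        datumOfRecord₁₃SepCoPH F 2 θ h = datumOfRecord₁₃SepCoPH F 2 θ' h' ∧ w.C = (datumOfRecord₁₃SepCoPH F 2 θ h).C ∧ (0 < w.γ ∧ w.γ ≤ θ'.γ) ∧
        w.L = (θ'.L : ℝ) ∧ ∀ P : B12.RunParams, w.up P = upOfRecord₅CS F 2 (θ'.toStage5₁₃CoPH F 2) P) →
      (∀ P : B12.RunParams, Nodes (leavesP w P)) → PrintedUV3V 2 θ.L →
      (∃ lam : ResidW F 2, (∀ P : B12.RunParams, 1 ≤ P.K → lam.kSel P < P.K) ∧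
        ∀ P : B12.RunParams, lam.kSel P < P.K → ((leavesP w P).rBasicStep ↔ B15Leaf (WOfRecord₁₃ F 2 θ.toStage13Params lam P))) →
      ∃ γ₀ : ℝ, 0 < γ₀ ∧ BetaLowerH 0 γ₀ (betaOfRecord₁₃ F 2 θ.toStage13Params) ∧ BetaUpperH w.βup γ₀ (betaOfRecord₁₃ F 2 θ.toStage13Params))
    (hinh : ∃ θ : Stage13HParams F 2, θ.Provisos₁₃SepCoPH F 2 ∧ (θ.ZhUnity F 2 ∧ θ.SlotsNondegenerate₁₃ F 2) ∧ θ.Admissible F 2) : False := by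
  obtain ⟨θ, h, w, hU, hθ, hR, hnodes, h08, hlam⟩ := h₁ F hinh
  refine signBoxAtEveryWitness_false F ⟨θ, h, w, hU, hθ, hR, hnodes, h08, hlam⟩ ?_
  intro θ₁ h₁' w₁ hr
  obtain ⟨hU₁, hθ₁, hR₁, hnodes₁, h08₁, hlam₁⟩ := hr
  exact hsign F θ₁ h₁' w₁ hU₁ hθ₁ hR₁ hnodes₁ h08₁ hlam₁

end AgainstTheRoad

end Summit.QuantumFields.YangMills.Theorems.StabilityBAtRecordR13SepCoPH.Negative.SignBoxAtEveryWitnessFalse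

end
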